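import Summits.HodgeConjecture.CorCM.CMAbelianFactorsDimLeThreeClassification
import Summits.HodgeConjecture.CorCM.CMCurvesAndSimpleSurfacesHodge
import HarnessLib

/-!
# Complex abelian varieties of CM type whose simple isogeny factors are CM elliptic curves and simple CM surfaces: all
# powers are divisor-generated iff no three pairwise non-isogenous simple surface factors have endomorphism fields with
# one Galois closure — the dihedral surface triple is the only obstruction

COR-CM (cell `pub-hodgecm2`, binder seat `b16` gen 44, count-neutral claim CM-DIMLE3-INTRINSIC, file F3; theorems only, no
definition, no named fact, no `sorry`).  NEW as stated (an assembly of tree theorems), hence under `Summits/`.  HONEST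
FRAMING: an unconditional classification theorem on complex abelian varieties of CM type, read on the variety; not a step of
the summit chain (`HC_CM` is neither used nor advanced).

THE THEOREM (`forall_isDivisorGenerated_powSucc_iff_of_isOfCMType_of_factors_dim_le_two`).  Let `X` be a complex abelian
variety of CM type (`Milne1999.IsOfCMType`) all of whose simple isogeny factors (`Domination.AVDominatedBy B X`, `B` simple)
have dimension `≤ 2` — `X` is isogenous to a product of powers of CM elliptic curves and simple CM abelian surfaces, in any
number.  Then ALL POWERS `X^{N+1}` are divisor-generated (`B• = D• ⊗ ℂ`) — and the Hodge conjecture holds for everything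
dominated by a power of `X`, UNCONDITIONALLY — IF AND ONLY IF (iii′) there are NO three pairwise non-isogenous simple
abelian SURFACES among the isogeny factors of `X` whose endomorphism fields have the same intrinsic Galois closure
`⨆_{f : End⁰(S) →+* ℂ} ℚ(range f) ≤ ℂ` (three of the four isogeny classes of simple CM surfaces inside one dihedral octic
closure).  This is the intrinsic form of seat p2's realisation-level census `CMCurvesAndSurfaces.isNondegenerateFamily_iff_
curves_simpleSurfaces`, obtained from the reduction `isDivisorGenerated_of_avDominatedBy_powSucc_of_forall_factorFamily` of
the prequel: in a family of simple, pairwise non-isogenous factors of `X` two curve slots never share their closure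
(separation), so three slots with one closure are three surfaces, excluded by (iii′) through `End⁰ ≅ K` (Shimura §5.1);
necessity is `exists_not_isDivisorGenerated_powSucc_of_three_surface_factors`.

LITERATURE SCOPE (recorded by seat p2 in `CorCM/SimpleCMSurfaceProductsHodge` for products; here on the variety, in the
shape used downstream).  J. J. Ramón-Marí, *On the Hodge conjecture for products of certain surfaces*, Collect. Math. 59
(2008), Prop. 2.18 states the Hodge conjecture for ALL products of complex abelian varieties of dimension `≤ 2`, reducing by
a pairwise Goursat argument to `Hg(A₁ × A₂) = Hg(A₁) × Hg(A₂)`; D. Lombardo, *On the ℓ-adic Galois representations attached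
to nonsimple abelian varieties*, Ann. Inst. Fourier 66 (2016), Cor. 4.5 deduces `H_ℓ(A) ≅ ∏ H_ℓ(A_i)` and Mumford–Tate for
`A ∼ ∏ A_i^{k_i}`, `A_i` absolutely simple of dimension `≤ 2` and pairwise non-isogenous, citing that proposition for the
Hodge groups of the CM factors.  For simple CM surfaces the Hodge groups are `2`-dimensional tori and pairwise splitting
does not propagate to triples: the tree's dihedral triple (`CorCM/DihedralReflexTripleCMHodge`; `rank Hg = 4 < 6`, an
exceptional `(2,2)`-class on `S₁ × S₂ × S₁′`) is a configuration of three pairwise non-isogenous simple CM abelian surfaces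
with `Hg(S₁ × S₂ × S₁′) ≠ Hg(S₁) × Hg(S₂) × Hg(S₁′)`.  The theorem below states exactly which `X` with factors of
dimension `≤ 2` have all powers divisor-generated; for the others the Hodge conjecture is NOT claimed here (their powers
carry exotic Hodge classes).

## References

* [MoonenZarhin1999LowDim] B. Moonen, Yu. Zarhin, *Hodge classes on abelian varieties of low dimension*, Math. Ann. 315
  (1999) 711–733, §3 (3.1), (3.9) and «Hodge groups of simple abelian surfaces of CM-type».
* [Gordon1999HodgeAVSurvey] B. B. Gordon, *A survey of the Hodge conjecture for abelian varieties*, §3 Theorem (Imai,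
  Murty), 7.5–7.7, 10.10.
* [Shimura1998] G. Shimura, *Abelian Varieties with Complex Multiplication and Modular Functions*, §5.1 Props. 3–6, §8.4
  Example (2).
* [MumfordAV1970] D. Mumford, *Abelian Varieties*, §19 Thm. 1, Cor. 1–2 (pp. 173–174).
-/

noncomputable section

open CategoryTheory CategoryTheory.Limits NumberField Module IntermediateField
open scoped BigOperators

namespace Summit.HodgeConjecture.CorCM

open Literature.NumberTheory.ComplexMultiplication
open Literature.AlgebraicGeometry.Motives (AbelianVariety CMType)
open Literature.AlgebraicGeometry.Motives.AbelianVariety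
open Literature.AlgebraicGeometry.HodgeTheory
open Literature.AlgebraicGeometry.ComplexMultiplication (IsCMTypeRealisation)
open Literature.AlgebraicGeometry.VanGeemen1994 (hodgeClassSpan)
open Literature.AlgebraicGeometry.Milne1999
open Literature.AlgebraicGeometry.Pohlmann1968
open Literature.Barriers.HodgeConjecture (divisorClassesSpan)
open Summit.HodgeConjecture.CorCM.Domination
open Summit.HodgeConjecture.HodgeConjecture.Ring2.ClassTargets (HCOnClass)
open Summit.HodgeConjecture.HodgeConjecture.Ring2.Atlas (nonempty_ringEquiv_endAlgebra_of_isSimple)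

variable {X : AbelianVariety ℂ}

/-! ## Simple isogeny factors of dimension `≤ 2`: only the dihedral surface triple obstructs -/

section DimLeTwo

/-- **MASTER FORM, factors of dimension `≤ 2`.**  Let `X` be a complex abelian variety of CM type all of whose simple isogeny
factors are CM elliptic curves or simple CM abelian surfaces, with NO three pairwise non-isogenous simple surface factors
whose endomorphism fields have one intrinsic Galois closure (iii′).  Then everything dominated by a power of `X` is
divisor-generated.  (The reduction of §1 with seat p2's census `isNondegenerateFamily_curves_simpleSurfaces_of_closures`: in a
family of simple, pairwise non-isogenous factors of `X` two curve slots never share their closure (separation), so three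
slots with one closure are three surfaces — excluded by (iii′) through `End⁰ ≅ K`.) UNCONDITIONAL.
[cite: MoonenZarhin1999LowDim, §3 (3.1), (3.9)] [cite: Gordon1999HodgeAVSurvey, §3 Theorem, 7.5–7.7] [cite: Shimura1998, §8.4] -/
theorem isDivisorGenerated_of_avDominatedBy_powSucc_of_isOfCMType_of_factors_dim_le_two (hcm : IsOfCMType X)
    (h2 : ∀ B : AbelianVariety ℂ, B.IsSimple → AVDominatedBy B X → B.dim ≤ 2)
    (hiii : ¬ ∃ S : Fin 3 → AbelianVariety ℂ, (∀ a, (S a).IsSimple ∧ (S a).dim = 2 ∧ AVDominatedBy (S a) X) ∧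
      (∀ a b, a ≠ b → ¬ IsIsogenous (S a) (S b)) ∧
      ∀ a b, (⨆ f : (S a).endAlgebra →+* ℂ, IntermediateField.adjoin ℚ (Set.range f)) =
        ⨆ f : (S b).endAlgebra →+* ℂ, IntermediateField.adjoin ℚ (Set.range f))
    {B : AbelianVariety ℂ} {N : ℕ} (hB : AVDominatedBy B (X.powSucc N)) : IsDivisorGenerated B := by
  classical
  refine isDivisorGenerated_of_avDominatedBy_powSucc_of_forall_factorFamily hcm ?_ hB
  intro C _ _ K' _ _ _ Φ' A' ι' θ' hA hs hniso hslot
  have heC : ∀ c, Nonempty (K' c ≃+* (A' c).endAlgebra) := fun c =>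
    nonempty_ringEquiv_endAlgebra_of_isSimple (hA c) (hs c)
  have hdim : ∀ c, finrank ℚ (K' c) = 2 ∨ finrank ℚ (K' c) = 4 := fun c => by
    have h := finrank_eq_two_mul_dim_of_isCMTypeRealisation (hA c)
    have hp : 0 < finrank ℚ (K' c) := Module.finrank_pos
    have hle := h2 _ (hs c) (hslot c)
    interval_cases hd : (A' c).dim <;> omega
  have hsep : CMAlgebra.IsSeparatingFamily Φ' :=
    CMAlgebra.isSeparatingFamily_of_isSimple_of_pairwise_not_isIsogenous hA hs hniso
  refine CMCurvesAndSurfaces.isNondegenerateFamily_curves_simpleSurfaces_of_closures hdim hA hs hniso ?_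
  intro i j k hij hjk hik hLij hLjk
  -- a curve slot never shares its closure with another slot
  rcases hdim i with h2i | h4i
  · exact CMCurvesAndSurfaces.normalClosure_ne_of_finrank_eq_two hdim hsep hij h2i hLij
  -- three quartic slots with one closure: a configuration excluded by (iii′)
  have h4 : ∀ l, normalClosure ℚ (K' l) ℂ = normalClosure ℚ (K' i) ℂ → finrank ℚ (K' l) = 4 := by
    intro l hl
    rcases hdim l with h2l | h4l
    · exfalso
      have hli : l ≠ i := by rintro rfl; omega
      exact CMCurvesAndSurfaces.normalClosure_ne_of_finrank_eq_two hdim hsep hli h2l hl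
    · exact h4l
  have hcard : (({i, j, k} : Finset C)).card = 3 := Finset.card_eq_three.2 ⟨i, j, k, hij, hik, hjk, rfl⟩
  obtain ⟨d, hd, hdmem⟩ := exists_injective_fin_of_le_card (n := 3) hcard.ge
  have hdL : ∀ x, normalClosure ℚ (K' (d x)) ℂ = normalClosure ℚ (K' i) ℂ := by
    intro x
    have hx : d x = i ∨ d x = j ∨ d x = k := by simpa using hdmem x
    rcases hx with h | h | h <;> rw [h]
    · exact hLij.symm
    · exact (hLij.trans hLjk).symm
  have h2d : ∀ x, (A' (d x)).dim = 2 := fun x => by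
    have h := finrank_eq_two_mul_dim_of_isCMTypeRealisation (hA (d x))
    rw [h4 (d x) (hdL x)] at h
    omega
  refine hiii ⟨fun x => A' (d x), fun x => ⟨hs (d x), h2d x, hslot (d x)⟩, fun x y hxy => hniso _ _ (hd.ne hxy),
    fun x y => ?_⟩
  obtain ⟨ex⟩ := heC (d x)
  obtain ⟨ey⟩ := heC (d y)
  change (⨆ f : (A' (d x)).endAlgebra →+* ℂ, IntermediateField.adjoin ℚ (Set.range f)) =
    ⨆ f : (A' (d y)).endAlgebra →+* ℂ, IntermediateField.adjoin ℚ (Set.range f)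
  rw [iSup_adjoin_range_eq_normalClosure ex, iSup_adjoin_range_eq_normalClosure ey, hdL x, hdL y]

/-- **THE CLASSIFICATION, factors of dimension `≤ 2`.**  For a complex abelian variety `X` of CM type all of whose simple isogeny
factors are CM elliptic curves or simple CM surfaces: ALL POWERS of `X` are divisor-generated IF AND ONLY IF there are no
three pairwise non-isogenous simple surface factors whose endomorphism fields have one intrinsic Galois closure (the dihedral
surface triple is the ONLY obstruction).  In particular the splitting `Hg(∏ A_i) = ∏ Hg(A_i)` for pairwise non-isogenous
simple CM abelian varieties `A_i` of dimension `≤ 2` (the CM input of Ramón-Marí 2008 Prop. 2.18 and Lombardo 2016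
Cor. 4.5) holds exactly when no three of the quartic endomorphism fields share their Galois closure.
[cite: MoonenZarhin1999LowDim, §3 (3.1), (3.9)] [cite: Gordon1999HodgeAVSurvey, §3 Theorem and 7.5–7.7] -/
theorem forall_isDivisorGenerated_powSucc_iff_of_isOfCMType_of_factors_dim_le_two (hcm : IsOfCMType X)
    (h2 : ∀ B : AbelianVariety ℂ, B.IsSimple → AVDominatedBy B X → B.dim ≤ 2) :
    (∀ N : ℕ, IsDivisorGenerated (X.powSucc N)) ↔
      ¬ ∃ S : Fin 3 → AbelianVariety ℂ, (∀ a, (S a).IsSimple ∧ (S a).dim = 2 ∧ AVDominatedBy (S a) X) ∧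
        (∀ a b, a ≠ b → ¬ IsIsogenous (S a) (S b)) ∧
        ∀ a b, (⨆ f : (S a).endAlgebra →+* ℂ, IntermediateField.adjoin ℚ (Set.range f)) =
          ⨆ f : (S b).endAlgebra →+* ℂ, IntermediateField.adjoin ℚ (Set.range f) := by
  refine ⟨fun h => ?_, fun h N =>
    isDivisorGenerated_of_avDominatedBy_powSucc_of_isOfCMType_of_factors_dim_le_two hcm h2 h (AVDominatedBy.refl _)⟩
  rintro ⟨S, hS, hSn, hSe⟩
  obtain ⟨N, hN⟩ := exists_not_isDivisorGenerated_powSucc_of_three_surface_factors hcm (fun a => (hS a).1)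
    (fun a => (hS a).2.1) (fun a => (hS a).2.2) hSn hSe
  exact hN (h N)

/-- **The Hodge conjecture for everything dominated by a power of a CM abelian variety whose simple isogeny factors have
dimension `≤ 2` and contain no dihedral surface triple** — UNCONDITIONALLY, all Hodge classes polynomials in divisor classes.
[cite: MoonenZarhin1999LowDim, §3 (3.1), (3.9)] [cite: Gordon1999HodgeAVSurvey, 10.10] -/
theorem hodgeConjectureFor_of_avDominatedBy_powSucc_of_isOfCMType_of_factors_dim_le_two (hcm : IsOfCMType X)
    (h2 : ∀ B : AbelianVariety ℂ, B.IsSimple → AVDominatedBy B X → B.dim ≤ 2)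
    (hiii : ¬ ∃ S : Fin 3 → AbelianVariety ℂ, (∀ a, (S a).IsSimple ∧ (S a).dim = 2 ∧ AVDominatedBy (S a) X) ∧
      (∀ a b, a ≠ b → ¬ IsIsogenous (S a) (S b)) ∧
      ∀ a b, (⨆ f : (S a).endAlgebra →+* ℂ, IntermediateField.adjoin ℚ (Set.range f)) =
        ⨆ f : (S b).endAlgebra →+* ℂ, IntermediateField.adjoin ℚ (Set.range f))
    {B : AbelianVariety ℂ} {N : ℕ} (hB : AVDominatedBy B (X.powSucc N)) : HodgeConjectureFor B.dim B.X :=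
  hodgeConjectureFor_of_isDivisorGenerated _
    (isDivisorGenerated_of_avDominatedBy_powSucc_of_isOfCMType_of_factors_dim_le_two hcm h2 hiii hB)


/-- **Class-target display** (`Ring2.ClassTargets.HCOnClass`): the Hodge conjecture on the class of complex abelian varieties
dominated by a power of a CM abelian variety whose simple isogeny factors have dimension `≤ 2` and contain no dihedral surface
triple (iii′). UNCONDITIONAL. [cite: MoonenZarhin1999LowDim, §3 (3.1), (3.9)] [cite: Gordon1999HodgeAVSurvey, 10.10] -/
theorem hcOnClass_avDominatedBy_powSucc_isOfCMType_factors_dim_le_two :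
    HCOnClass fun B => ∃ (X : AbelianVariety ℂ) (N : ℕ), IsOfCMType X ∧
      (∀ B : AbelianVariety ℂ, B.IsSimple → AVDominatedBy B X → B.dim ≤ 2) ∧
      (¬ ∃ S : Fin 3 → AbelianVariety ℂ, (∀ a, (S a).IsSimple ∧ (S a).dim = 2 ∧ AVDominatedBy (S a) X) ∧
          (∀ a b, a ≠ b → ¬ IsIsogenous (S a) (S b)) ∧
          ∀ a b, (⨆ f : (S a).endAlgebra →+* ℂ, IntermediateField.adjoin ℚ (Set.range f)) =
            ⨆ f : (S b).endAlgebra →+* ℂ, IntermediateField.adjoin ℚ (Set.range f)) ∧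
      AVDominatedBy B (X.powSucc N) :=
  fun _ ⟨_, _, hcm, h2, hiii, hB⟩ =>
    hodgeConjectureFor_of_avDominatedBy_powSucc_of_isOfCMType_of_factors_dim_le_two hcm h2 hiii hB

end DimLeTwo

end Summit.HodgeConjecture.CorCM

end
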